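import Summits.PneNP.PneNP.Theorems.ChebyshevTracialDesignTiltedSmallBlockAmplitudeOne
import Summits.PneNP.PneNP.Theorems.ChebyshevTracialDesignHSymmetricAmplitudeOne
import HarnessLib

/-!
# Cell pnp-psdrank, route `ChebyshevTracialDesign`: (CG_1′) FOR ONE-BLOCK MASKS ON SMALL BLOCKS IN ALL DIRECTIONS, LITERAL FORM
# (brick 155; crux `TracialDecayExp20`, stmt-PneNP-19878)

Brick 155 (prover g30; MEMO-33 §4). The small-block companion of bricks 145/145p (prover g29: (CG_1′) for BALANCED `H`-symmetric masks in
all matching-dependent directions). Brick 148 §4 (`colourSymmetric_allDirections_reduction`) bounds the containment form of a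
colour-symmetric mask in ANY pair-symmetric direction field by its value at the colour-type-AVERAGED field plus the `r = 1` excess
`8Gn⁶γ` (`γ = 20e^{−a·dq n}`, the unconditional rung `rectangleDecayExp_all_holds`); for the colouring `𝟙_{H̄}` the averaged field is
type-constant for `(H, M)` (`typeConstant_of_colour`) and brick 153's turnkey bound applies (blocks with `4|H| ≤ ⌊√n⌋`, admissible `R`
from brick 154's `sqrt_block_admissible`):

* `typeConstant_of_colour`;
* **`smallBlock_allDirections_pairSymm_le`** — for every pair-symmetric field `|c_M| ≤ 1`:
  `Σ_M Σ_U W(U,M)ψ(|U∩H|)(Σ_p c_M(p)x_px_{π_Mp})² ≤ 20G((5t+5Tq n+4)² + (|H|+1)n²)(1/3)^{⌊dq n/2⌋−1} + 160Gn⁶e^{−a·dq n}`;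
* **`smallBlock_containment_allDirections_decay`** — the LITERAL (CG_1′): `Σ_M (Σ_U W ψ (Σ_p v_M(p)x_px_{π_Mp})²)₊ ≤` the same, for EVERY
  field `|v_M| ≤ 1` (145p's positive-part trick + `containment_pairSymm`).
READING: eng MEMO-26 §4's target «(CG_1′) for one-block masks on small blocks, all directions» in its literal form, for `|H| ≤ √n/4`; the
type-constant part is EFFECTIVE (brick 153), the excess inherits the asymptotic `a` of the `r = 1` rung. WHAT THIS FILE DOES NOT DO:
`√n ≲ |H| < n/2`; several blocks; anything on `TracialDecayExp20` itself, psd rank of P_PM(K_n), or P vs NP.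
[cite: Rothvoss2017, §2 and Lemma 7 (PDF pp. 5–8)] [cite: KeevashLifshitz2023, Thm. 1.8]
Stature: support/instrument (kernel lane, no defs, axioms standard). Supports stmt-PneNP-19878.
-/

set_option linter.dupNamespace false -- `Summit.PneNP.PneNP.…`: summit = sub-problem (D-0017)

noncomputable section

namespace Summit.PneNP.PneNP.Theorems.ChebyshevTracialDesignTiltedSmallBlockAllDirections

open Finset Literature.Barriers.PneNP Literature.Combinatorics.Optimization
open Summit.PneNP.PneNP.Theorems.ChebyshevTracialDesignColourSymmetricReduction (colourSymmetric_allDirections_reduction)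
open Summit.PneNP.PneNP.Theorems.ChebyshevTracialDesignUnconditionalRungs (rectangleDecayExp_all_holds)
open Summit.PneNP.PneNP.Theorems.ChebyshevTracialDesignAllDirections (abs_classAvg_le_one)
open Summit.PneNP.PneNP.Theorems.ChebyshevTracialDesignHSymmetricAmplitudeOne (containment_pairSymm)
open Summit.PneNP.PneNP.Theorems.ChebyshevTracialDesignTiltedSmallBlockAverage (tilted_designValue_avg_le_three_pow)
open Summit.PneNP.PneNP.Theorems.ChebyshevTracialDesignTiltedSmallBlockAmplitudeOne (card_map_inter_eq dq_facts
  sqrt_block_admissible)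

variable {n : ℕ}

/-- **Type-constancy from the two-colouring.** With `col = 𝟙_{H̄}`, a direction that depends only on the colour type
`s(col p, col πp)` is constant on the `HH`-type, on the mixed and on the `H̄H̄`-type vertices. [cite: Rothvoss2017, §2 (PDF p. 5)] -/
theorem typeConstant_of_colour (H : Finset (Fin n)) (π : Fin n → Fin n) (col : Fin n → Fin 2)
    (hc0 : ∀ p, p ∈ H → col p = 0) (hc1 : ∀ p, p ∉ H → col p = 1) (v : Fin n → ℝ)
    (hvt : ∀ p p', s(col p, col (π p)) = s(col p', col (π p')) → v p = v p') :
    (∀ p p', p ∈ H → π p ∈ H → p' ∈ H → π p' ∈ H → v p = v p') ∧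
    (∀ p p', ((p ∈ H ∧ π p ∉ H) ∨ (p ∉ H ∧ π p ∈ H)) → ((p' ∈ H ∧ π p' ∉ H) ∨ (p' ∉ H ∧ π p' ∈ H)) → v p = v p') ∧
    (∀ p p', p ∉ H → π p ∉ H → p' ∉ H → π p' ∉ H → v p = v p') := by
  refine ⟨fun p p' h1 h2 h3 h4 => hvt p p' (by rw [hc0 _ h1, hc0 _ h2, hc0 _ h3, hc0 _ h4]), fun p p' hp hp' => hvt p p' ?_,
    fun p p' h1 h2 h3 h4 => hvt p p' (by rw [hc1 _ h1, hc1 _ h2, hc1 _ h3, hc1 _ h4])⟩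
  have e : ∀ q, ((q ∈ H ∧ π q ∉ H) ∨ (q ∉ H ∧ π q ∈ H)) → s(col q, col (π q)) = s((0 : Fin 2), (1 : Fin 2)) := by
    intro q hq
    rcases hq with ⟨h1, h2⟩ | ⟨h1, h2⟩
    · rw [hc0 _ h1, hc1 _ h2]
    · rw [hc1 _ h1, hc0 _ h2, Sym2.eq_swap]
  rw [e p hp, e p' hp']

/-- **(CG_1′) FOR ONE-BLOCK MASKS ON SMALL BLOCKS, pair-symmetric fields.** There are `a > 0` and `n₀` such that for all even `n ≥ n₀`,
every balanced `B = 20` Chebyshev design `(t, C, w)`, every block `H` with `4|H| ≤ ⌊√n⌋`, every mask `0 ≤ ψ ≤ G` on `[0,t]` and every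
pair-symmetric direction field `c_M : [n] → [−1,1]` (`c_M(π_M p) = c_M(p)`):
`Σ_M Σ_U W(U,M)·ψ(|U∩H|)·(Σ_p c_M(p) x_p x_{π_M p})² ≤ 20G((5t+5Tq n+4)² + (|H|+1)n²)(1/3)^{⌊dq n/2⌋−1} + 160Gn⁶e^{−a·dq n}`
(brick 148 §4: all directions ≤ colour-type-constant directions + the `r = 1` excess; brick 153 for the type-constant part).
[cite: Rothvoss2017, §2 and Lemma 7 (PDF pp. 5–8)] [cite: KeevashLifshitz2023, Thm. 1.8] -/
theorem smallBlock_allDirections_pairSymm_le :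
    ∃ a : ℝ, 0 < a ∧ ∃ n₀ : ℕ, ∀ n : ℕ, n₀ ≤ n → Even n → ∀ {t : ℕ} {C : Finset ℕ} {w : ℕ → ℝ},
    IsBalancedDesign n t (Tq n) (dq n) 20 C w →
    ∀ (H : Finset (Fin n)), 4 * H.card ≤ Nat.sqrt n →
    ∀ (ψ : ℤ → ℝ) {G : ℝ}, 0 ≤ G → (∀ x ∈ Icc (0 : ℤ) (t : ℤ), |ψ x| ≤ G) → (∀ x ∈ Icc (0 : ℤ) (t : ℤ), 0 ≤ ψ x) →
    ∀ (c : PMatch n → Fin n → ℝ), (∀ M p, |c M p| ≤ 1) → (∀ M p, c M (M.2.partner p) = c M p) →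
    ∑ M : PMatch n, ∑ U : OddSet n, levelWeight n t C w U M *
        (ψ ((U.1 ∩ H).card : ℤ) *
          (∑ p : Fin n, c M p * ((if p ∈ U.1 then (1 : ℝ) else 0) * (if M.2.partner p ∈ U.1 then (1 : ℝ) else 0))) ^ 2) ≤
      20 * G * ((5 * (t : ℝ) + 5 * (Tq n) + 4) ^ 2 + ((H.card : ℝ) + 1) * (n : ℝ) ^ 2) * (1 / 3 : ℝ) ^ (dq n / 2 - 1) +
        160 * G * (n : ℝ) ^ 6 * Real.exp (-(a * dq n)) := by
  classical
  obtain ⟨a, ha, n₁, hrung⟩ := rectangleDecayExp_all_holds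
  refine ⟨a, ha, max n₁ (324 * 324), ?_⟩
  intro n hn heven t C w hbal H hh4 ψ G hG0 hG hψ0 c hc hcπ
  have hn₁ : n₁ ≤ n := le_trans (le_max_left _ _) hn
  have hm : 324 ≤ Nat.sqrt n := by rw [Nat.le_sqrt]; exact le_trans (le_max_right _ _) hn
  have h256 : 256 ≤ n := le_trans (by norm_num) (le_trans (le_max_right _ _) hn)
  obtain ⟨hD4, hDT⟩ := dq_facts h256
  have hdes : IsExactDesign n t (Tq n) (dq n) 20 C w := hbal.1
  have hN : (univ : Finset (Fin n)).card = 2 * (n / 2) := by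
    rw [card_univ, Fintype.card_fin]; obtain ⟨k, hk⟩ := heven; omega
  have hn4 : n ≤ 4 * t := hbal.2
  have h2t : 2 * t + 2 ≤ n := hbal.1.2.1
  obtain ⟨s₀, hs₀⟩ := hbal.1.1
  obtain ⟨h9, hR1, hRa, hRb, hq, hθ⟩ := sqrt_block_admissible (n := n) (h := H.card) hs₀ hn4 h2t hh4 hm
  have hht : H.card ≤ t := by omega
  have h2h : 2 * H.card ≤ n := by omega
  have hR := hrung n hn₁ heven t C w hbal
  -- colouring, mask, invariance
  set col : Fin n → Fin 2 := fun p => if p ∈ H then 0 else 1 with hcol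
  have hc0 : ∀ p, p ∈ H → col p = 0 := fun p hp => by rw [hcol]; simp [hp]
  have hc1 : ∀ p, p ∉ H → col p = 1 := fun p hp => by rw [hcol]; simp [hp]
  have hcolH : ∀ p, col p = 0 ↔ p ∈ H := fun p => by
    by_cases hp : p ∈ H
    · simp [hc0 p hp, hp]
    · simp [hc1 p hp, hp]
  set f : Finset (Fin n) → ℝ := fun U => ψ ((U ∩ H).card : ℤ) with hf
  have hUH : ∀ U : Finset (Fin n), ((U ∩ H).card : ℤ) ∈ Icc (0 : ℤ) (t : ℤ) := by
    intro U
    rw [mem_Icc]; refine ⟨by positivity, ?_⟩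
    have := card_le_card (inter_subset_right (s₁ := U) (s₂ := H))
    exact_mod_cast this.trans hht
  have hf0 : ∀ U, 0 ≤ f U := fun U => hψ0 _ (hUH U)
  have hfG : ∀ U, f U ≤ G := fun U => (le_abs_self _).trans (hG _ (hUH U))
  have hfinv : ∀ (M : PMatch n) (g : Equiv.Perm (Fin n)), (∀ i, g (M.2.partner i) = M.2.partner (g i)) →
      (∀ i, col (g i) = col i) → ∀ U : Finset (Fin n), f (U.map g.toEmbedding) = f U := by
    intro M g _ hg U
    rw [hf]
    simp only
    rw [card_map_inter_eq H U g (fun i => by rw [← hcolH, ← hcolH, hg i])]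
  have h148 := colourSymmetric_allDirections_reduction hbal.1.1 C w hR col f hG0 hf0 hfG hfinv c hc hcπ
  -- the type-averaged field is type-constant and bounded by one: brick 153
  set v : PMatch n → Fin n → ℝ := fun M p =>
    (∑ q ∈ univ.filter (fun q => s(col q, col (M.2.partner q)) = s(col p, col (M.2.partner p))), c M q) /
      ((univ.filter fun q => s(col q, col (M.2.partner q)) = s(col p, col (M.2.partner p))).card : ℝ) with hvdef
  have hv1 : ∀ M p, |v M p| ≤ 1 := fun M p => abs_classAvg_le_one _ (c M) (hc M)
  have hvt : ∀ (M : PMatch n) p p', s(col p, col (M.2.partner p)) = s(col p', col (M.2.partner p')) → v M p = v M p' :=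
    fun M p p' hpp' => by simp only [hvdef, hpp']
  have htc : ∀ M : PMatch n, _ := fun M => typeConstant_of_colour H M.2.partner col hc0 hc1 (v M) (hvt M)
  have h153 := tilted_designValue_avg_le_three_pow hdes hN H rfl h9 h2h hs₀ hD4 hDT hR1 hRa hRb hq hθ ψ hG0 hG hψ0 v hv1
    (fun M => (htc M).1) (fun M => (htc M).2.1) (fun M => (htc M).2.2)
  simp only [hf, hvdef] at h148 h153
  linarith [h148, h153]

/-- **(CG_1′) FOR ONE-BLOCK MASKS ON SMALL BLOCKS, LITERAL FORM (brick 155).** For some `a > 0` and all large even `n`: every balanced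
`B = 20` Chebyshev design `(t, C, w)`, every block `H` with `4|H| ≤ ⌊√n⌋`, every mask `0 ≤ ψ ≤ G` on `[0,t]` and EVERY direction field
`v : PM_n → [n] → [−1,1]` satisfy
`Σ_M (Σ_U W(U,M)·ψ(|U∩H|)·(Σ_p v_M(p)·x_p x_{π_M p})²)₊ ≤ 20G((5t+5Tq n+4)² + (|H|+1)n²)(1/3)^{⌊dq n/2⌋−1} + 160Gn⁶e^{−a·dq n}`
(the small-block companion of brick 145p). [cite: Rothvoss2017, §2 and Lemma 7 (PDF pp. 5–8)] [cite: KeevashLifshitz2023, Thm. 1.8] -/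
theorem smallBlock_containment_allDirections_decay :
    ∃ a : ℝ, 0 < a ∧ ∃ n₀ : ℕ, ∀ n : ℕ, n₀ ≤ n → Even n → ∀ {t : ℕ} {C : Finset ℕ} {w : ℕ → ℝ},
    IsBalancedDesign n t (Tq n) (dq n) 20 C w →
    ∀ (H : Finset (Fin n)), 4 * H.card ≤ Nat.sqrt n →
    ∀ (ψ : ℤ → ℝ) {G : ℝ}, 0 ≤ G → (∀ x ∈ Icc (0 : ℤ) (t : ℤ), |ψ x| ≤ G) → (∀ x ∈ Icc (0 : ℤ) (t : ℤ), 0 ≤ ψ x) →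
    ∀ (v : PMatch n → Fin n → ℝ), (∀ M p, |v M p| ≤ 1) →
    ∑ M : PMatch n, max (∑ U : OddSet n, levelWeight n t C w U M *
        (ψ ((U.1 ∩ H).card : ℤ) *
          (∑ p : Fin n, v M p * ((if p ∈ U.1 then (1 : ℝ) else 0) * (if M.2.partner p ∈ U.1 then (1 : ℝ) else 0))) ^ 2)) 0 ≤
      20 * G * ((5 * (t : ℝ) + 5 * (Tq n) + 4) ^ 2 + ((H.card : ℝ) + 1) * (n : ℝ) ^ 2) * (1 / 3 : ℝ) ^ (dq n / 2 - 1) +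
        160 * G * (n : ℝ) ^ 6 * Real.exp (-(a * dq n)) := by
  classical
  obtain ⟨a, ha, n₀, h155⟩ := smallBlock_allDirections_pairSymm_le
  refine ⟨a, ha, n₀, ?_⟩
  intro n hn hev t C w hdes H hH ψ G hG0 hG hψ0 v hv
  obtain ⟨c, hc⟩ : ∃ c : PMatch n → Fin n → ℝ, ∀ M p, c M p =
      if 0 ≤ ∑ U : OddSet n, levelWeight n t C w U M * (ψ ((U.1 ∩ H).card : ℤ) *
          (∑ p : Fin n, v M p * ((if p ∈ U.1 then (1 : ℝ) else 0) * (if M.2.partner p ∈ U.1 then (1 : ℝ) else 0))) ^ 2)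
      then (v M p + v M (M.2.partner p)) / 2 else 0 := ⟨_, fun _ _ => rfl⟩
  have hc1 : ∀ M p, |c M p| ≤ 1 := fun M p => by
    rw [hc]
    split_ifs
    · have h1 := abs_le.1 (hv M p); have h2 := abs_le.1 (hv M (M.2.partner p))
      rw [abs_le]; constructor <;> linarith
    · simp
  have hcπ : ∀ M p, c M (M.2.partner p) = c M p := fun M p => by
    rw [hc, hc, M.2.partner_partner]
    split_ifs <;> ring
  have key := h155 n hn hev hdes H hH ψ hG0 hG hψ0 c hc1 hcπ
  refine le_trans (le_of_eq (sum_congr rfl fun M _ => ?_)) key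
  by_cases hpos : 0 ≤ ∑ U : OddSet n, levelWeight n t C w U M * (ψ ((U.1 ∩ H).card : ℤ) *
      (∑ p : Fin n, v M p * ((if p ∈ U.1 then (1 : ℝ) else 0) * (if M.2.partner p ∈ U.1 then (1 : ℝ) else 0))) ^ 2)
  · rw [max_eq_left hpos]
    refine Fintype.sum_congr _ _ fun U => ?_
    rw [containment_pairSymm M U.1 (v M)]
    congr 3
    refine sum_congr rfl fun p _ => ?_
    rw [hc, if_pos hpos]
  · rw [max_eq_right (le_of_lt (lt_of_not_ge hpos))]
    symm
    refine sum_eq_zero fun U _ => ?_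
    have : ∑ p : Fin n, c M p * ((if p ∈ U.1 then (1 : ℝ) else 0) * (if M.2.partner p ∈ U.1 then (1 : ℝ) else 0)) = 0 :=
      sum_eq_zero fun p _ => by rw [hc, if_neg hpos, zero_mul]
    rw [this]; ring

end Summit.PneNP.PneNP.Theorems.ChebyshevTracialDesignTiltedSmallBlockAllDirections

end
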